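import Summits.CriticalPhenomena.PercolationContinuityZ3.Theorems.PercNearOneGluingNoHeavyLowerTailCovTauA2Edge
import Summits.CriticalPhenomena.PercolationContinuityZ3.Theorems.PercNearOneGluingNoHeavyLowerTailCovTauA2Anti
import HarnessLib

/-!
# Crux `NoHeavyLowerTail` (stmt-CriticalPhenomena-4575): (A2) and P1 ≥ 0 for EDGE-cluster functionals, modulo the
# one-source bounds only

Support file (`--supports stmt-CriticalPhenomena-4575`, prover prim-hp-4 gen 9).  No named facts, no sorries, no
`Prop` definitions.  Verbatim `…CovTauA2Anti.lean` for a monotone functional `g ≥ 0` of the open EDGE cluster: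
`Y` is antitone in the source set given the one-source bound `Y_{U'}({u}) ≤ B_{U'}` (conditioning on the value of
`C_N`, `CovTau.sum_cond_sC`), hence
* `CovTau.a2E` — (A2) `E_U(N)·Y_U(N') ≤ M_U(N ∪ N')·X_U(N ∩ N')`, and
* `CovTau.p1E` — its diagonal, prim-hp-8's P1 ≥ 0 = the "A2-diagonal" consumed by `CovTau.covTau_of_diagonal`
  (up to the sum/measure dictionary),
with hypotheses (★_N) `Y_{U'}(N)·M_{U'}(∅) ≤ M_{U'}(N)·B_{U'}` and (Y ≤ B) `Y_{U'}({u}) ≤ B_{U'}` in every sub-world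
`U' ⊆ U` — one-source statements (decision-tree Harris [Gladkov2024, Thm. 3.2] + vdBHK Thm. 1.4; tree:
`CovTauStarN.starN_ED` of prim-ineq-prove-1 in the finitary `ED` calculus).
[cite: VandenbergHaggstromKahn2005, Thm. 1.1 (pp. 3–5), §1 pp. 7–8] [cite: Gladkov2024, Thm. 3.2] [cite: KozmaNitzan2024, Conj. 1 (p. 3)]
-/

noncomputable section

namespace Summit.CriticalPhenomena.PercolationContinuityZ3.Theorems.CovTau

open Literature.Probability.Percolation
open Literature.Probability.Percolation.BHK2006
open Literature.Probability.Percolation.DecisionTree (ind ind_of_mem ind_of_not_mem ind_nonneg)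
open scoped Classical

variable {V : Type*} [Fintype V]

/-- **Adding a source vertex decreases `Y`** (COV-TAU-PROOF §3, Corollary): if `Y_{U'}({u}) ≤ B_{U'}` in every
sub-world `U' ⊆ U`, then `Y_U(N ∪ {u}) ≤ Y_U(N)`. [cite: VandenbergHaggstromKahn2005, §1 pp. 7–8] -/
theorem YfE_insert_le (w : Sym2 V → ℝ) (hw0 : ∀ e, 0 ≤ w e) (hw1 : ∀ e, w e ≤ 1)
    (hm : ∑ ω, weight w ω = 1) (x v : V) (g : Set (Sym2 V) → ℝ) (U : Finset V)
    (hYB : ∀ U' ⊆ U, ∀ u : V, YfE w U' x v g {u} ≤ BfE w U' x v g) (N : Set V) (u : V) :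
    YfE w U x v g (insert u N) ≤ YfE w U x v g N := by
  -- the integrand of `Y(N ∪ {u})` as a function of `(C_N, ω ∩ E(U ∖ C_N))`
  set Φ : Set V → Set (Sym2 V) → ℝ := fun W η =>
    ind {W : Set V | x ∉ W} W * (if u ∈ W then BfE w (U.filter fun a => a ∉ W) x v g else
      BfE w (rest (U.filter fun a => a ∉ W) ({u} : Set V) η) x v g *
        ind (rD (U.filter fun a => a ∉ W) x ({u} : Set V)) η) with hΦ
  have hxW : ∀ ω : Set (Sym2 V), ind {W : Set V | x ∉ W} (sC U N ω) = ind (rD U x N) ω := by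
    intro ω
    by_cases h : x ∈ sC U N ω
    · rw [ind_of_not_mem (show sC U N ω ∉ {W : Set V | x ∉ W} from fun h' => h' h),
        ind_of_not_mem (fun h' => ((not_mem_sC_iff U N ω x).2 h') h)]
    · rw [ind_of_mem (show sC U N ω ∈ {W : Set V | x ∉ W} from h), ind_of_mem ((not_mem_sC_iff U N ω x).1 h)]
  have hint : ∀ ω : Set (Sym2 V), BfE w (rest U (insert u N) ω) x v g * ind (rD U x (insert u N)) ω =
      Φ (sC U N ω) (ω ∩ edgesIn (rest U N ω)) := by
    intro ω
    simp only [hΦ, hxW, ← rest_eq_filter, rest_inter_edgesIn]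
    by_cases hu : u ∈ sC U N ω
    · rw [if_pos hu]
      have hC : sC U (insert u N) ω = sC U N ω := sC_insert_of_mem hu
      have hR : rest U (insert u N) ω = rest U N ω := by
        ext a; rw [mem_rest, mem_rest, hC]
      rw [hR]
      by_cases hx : ω ∈ rD U x N
      · have hx' : ω ∈ rD U x (insert u N) := by
          rw [← not_mem_sC_iff] at hx ⊢; rwa [hC]
        rw [ind_of_mem hx, ind_of_mem hx', mul_one, one_mul]
      · have hx' : ω ∉ rD U x (insert u N) := fun h => hx (rD_antitone (Set.subset_insert u N) h)
        rw [ind_of_not_mem hx, ind_of_not_mem hx', mul_zero, zero_mul]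
    · rw [if_neg hu, rest_insert_of_not_mem hu]
      by_cases hx : ω ∈ rD U x N
      · rw [ind_of_mem hx, one_mul]
        have hxC : x ∉ sC U N ω := (not_mem_sC_iff U N ω x).2 hx
        have hiff : ω ∈ rD U x (insert u N) ↔ ω ∩ edgesIn (rest U N ω) ∈ rD (rest U N ω) x ({u} : Set V) := by
          rw [mem_rD_inter_edgesIn]
          simp only [rD, Set.mem_setOf_eq, Set.mem_insert_iff, Set.mem_singleton_iff, forall_eq_or_imp, forall_eq,
            reach_rest_iff hxC]
          exact ⟨fun h => h.1, fun h => ⟨h, hx⟩⟩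
        by_cases hx' : ω ∈ rD U x (insert u N)
        · rw [ind_of_mem hx', ind_of_mem (hiff.1 hx')]
        · rw [ind_of_not_mem hx', ind_of_not_mem fun h => hx' (hiff.2 h)]
      · have hx' : ω ∉ rD U x (insert u N) := fun h => hx (rD_antitone (Set.subset_insert u N) h)
        rw [ind_of_not_mem hx, ind_of_not_mem hx', mul_zero, zero_mul]
  -- condition on `C_N`; inside, the `u ∉ W` branch is `Y_{U∖W}({u}) ≤ B_{U∖W}`
  have hdec := sum_cond_sC w hm U N Φ
  unfold YfE
  simp_rw [hint]
  rw [hdec]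
  refine Finset.sum_le_sum fun ω _ => mul_le_mul_of_nonneg_left ?_ (weight_nonneg hw0 hw1 ω)
  simp only [hΦ, ← rest_eq_filter]
  by_cases hu : u ∈ sC U N ω
  · simp only [if_pos hu]
    rw [← Finset.sum_mul, hm, one_mul, hxW]
    exact (mul_comm _ _).le
  · simp only [if_neg hu, hxW]
    have hsum : ∑ ω', weight w ω' * (ind (rD U x N) ω *
        (BfE w (rest (rest U N ω) ({u} : Set V) (ω' ∩ edgesIn (rest U N ω))) x v g *
          ind (rD (rest U N ω) x ({u} : Set V)) (ω' ∩ edgesIn (rest U N ω)))) =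
        ind (rD U x N) ω * YfE w (rest U N ω) x v g {u} := by
      unfold YfE
      rw [Finset.mul_sum]
      refine Finset.sum_congr rfl fun ω' _ => ?_
      rw [rest_inter_edgesIn]
      have : ind (rD (rest U N ω) x ({u} : Set V)) (ω' ∩ edgesIn (rest U N ω)) =
          ind (rD (rest U N ω) x ({u} : Set V)) ω' := by
        by_cases h : ω' ∈ rD (rest U N ω) x ({u} : Set V)
        · rw [ind_of_mem h, ind_of_mem ((mem_rD_inter_edgesIn _ _ _ _).2 h)]
        · rw [ind_of_not_mem h, ind_of_not_mem fun h' => h ((mem_rD_inter_edgesIn _ _ _ _).1 h')]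
      rw [this]; ring
    rw [hsum, mul_comm (BfE w (rest U N ω) x v g)]
    exact mul_le_mul_of_nonneg_left (hYB _ (rest_subset U N ω) u) (ind_nonneg _ _)

/-- **`Y` is antitone in the source set** given the one-source bound `Y_{U'}({u}) ≤ B_{U'}` in every sub-world
(COV-TAU-PROOF §3, Corollary). [cite: VandenbergHaggstromKahn2005, §1 pp. 7–8] -/
theorem YfE_antitone_of_le_BfE (w : Sym2 V → ℝ) (hw0 : ∀ e, 0 ≤ w e) (hw1 : ∀ e, w e ≤ 1)
    (hm : ∑ ω, weight w ω = 1) (x v : V) (g : Set (Sym2 V) → ℝ) (U : Finset V)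
    (hYB : ∀ U' ⊆ U, ∀ u : V, YfE w U' x v g {u} ≤ BfE w U' x v g) {N N' : Set V} (hNN' : N ⊆ N')
    (hN'U : N' ⊆ ↑U) : YfE w U x v g N' ≤ YfE w U x v g N := by
  -- induction on the finite set `N' ∖ N`
  set D : Finset V := U.filter fun u => u ∈ N' ∧ u ∉ N with hD
  have hN' : N' = N ∪ ↑D := by
    ext u
    simp only [hD, Set.mem_union, Finset.coe_filter, Set.mem_setOf_eq]
    constructor
    · intro hu; by_cases huN : u ∈ N; exacts [Or.inl huN, Or.inr ⟨hN'U hu, hu, huN⟩]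
    · rintro (hu | ⟨-, hu, -⟩); exacts [hNN' hu, hu]
  rw [hN']
  clear_value D
  clear hN' hD
  induction D using Finset.induction_on with
  | empty => simp
  | @insert u D _ ih =>
    rw [Finset.coe_insert, Set.union_insert]
    exact (YfE_insert_le w hw0 hw1 hm x v g U hYB _ u).trans ih

/-- **(A2) modulo the one-source bounds** (★) and (Y ≤ B): for all `N, N' ⊆ U`,
`E_U(N)·Y_U(N') ≤ M_U(N ∪ N')·X_U(N ∩ N')`.
[cite: VandenbergHaggstromKahn2005, Thm. 1.1 (pp. 3–5)] [cite: Gladkov2024, Thm. 3.2] -/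
theorem a2E (w : Sym2 V → ℝ) (hw0 : ∀ e, 0 ≤ w e) (hw1 : ∀ e, w e ≤ 1)
    (hm : ∑ ω, weight w ω = 1) (x o v : V) {g : Set (Sym2 V) → ℝ}
    (hg : Monotone g) (hg0 : ∀ C, 0 ≤ g C) (U : Finset V)
    (hstar : ∀ U' ⊆ U, ∀ N : Set V, N ⊆ ↑U' →
      YfE w U' x v g N * Mf w U' x v ∅ ≤ Mf w U' x v N * BfE w U' x v g)
    (hYB : ∀ U' ⊆ U, ∀ u : V, YfE w U' x v g {u} ≤ BfE w U' x v g) {N N' : Set V} (hNU : N ⊆ ↑U)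
    (hN'U : N' ⊆ ↑U) :
    Ef w U x o v N * YfE w U x v g N' ≤ Mf w U x v (N ∪ N') * XfE w U x o v g (N ∩ N') :=
  a2E_of_star w hw0 hw1 hm x o v hg hg0 U hstar
    (fun U' hU' _ _ hNN' hN'U' => YfE_antitone_of_le_BfE w hw0 hw1 hm x v g U'
      (fun U'' hU'' => hYB U'' (hU''.trans hU')) hNN' hN'U') N N' hNU hN'U

/-- **P1 ≥ 0 modulo the one-source bounds**: `E({y})·Y({y}) ≤ M({y})·X({y})` in `G[U]`, i.e.
`E_π[(q(C_y) − τ)B(C_y)] ≥ 0` (COV-TAU-PROOF §5(a)). [cite: VandenbergHaggstromKahn2005, Thm. 1.1 (pp. 3–5)]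
[cite: Gladkov2024, Thm. 3.2] -/
theorem p1E (w : Sym2 V → ℝ) (hw0 : ∀ e, 0 ≤ w e) (hw1 : ∀ e, w e ≤ 1)
    (hm : ∑ ω, weight w ω = 1) (x o v y : V) {g : Set (Sym2 V) → ℝ}
    (hg : Monotone g) (hg0 : ∀ C, 0 ≤ g C) (U : Finset V) (hy : y ∈ U)
    (hstar : ∀ U' ⊆ U, ∀ N : Set V, N ⊆ ↑U' →
      YfE w U' x v g N * Mf w U' x v ∅ ≤ Mf w U' x v N * BfE w U' x v g)
    (hYB : ∀ U' ⊆ U, ∀ u : V, YfE w U' x v g {u} ≤ BfE w U' x v g) :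
    Ef w U x o v {y} * YfE w U x v g {y} ≤ Mf w U x v {y} * XfE w U x o v g {y} := by
  have h := a2E w hw0 hw1 hm x o v hg hg0 U hstar hYB (N := {y}) (N' := {y})
    (Set.singleton_subset_iff.2 hy) (Set.singleton_subset_iff.2 hy)
  simpa only [Set.union_self, Set.inter_self] using h

end Summit.CriticalPhenomena.PercolationContinuityZ3.Theorems.CovTau
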